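import Summits.Ventures.KdS.ModeStability
import Summits.Ventures.KdS.MasslessScalar
import Literature.Geometry.Lorentzian.KerrDeSitterRadialEnergyIdentity
import HarnessLib

/-!
# Venture KdS — HYPOTHESIS-FREE off-window exclusion for the scalar columns (sharp radius `|m|ϖ₁`)

HONEST FRAMING (venture `Summits/Ventures/KdS`, cell `pub-kds`; lead rulings A26′ 07:57:43Z and A40 (ii)
09:01:47Z): bookkeeping over two Literature THEOREMS of
`Literature/Geometry/Lorentzian/KerrDeSitterRadialEnergyIdentity.lean` (Casals–Teixeira da Costa 2022,
proof of Thm 3.10 Step 1 at `s = 0`, with Lemma 3.1 (3.7) discharged): `hasMode_zero_window'`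
(conformal scalar, Teukolsky `s = 0`) and `masterMode_zero_window'` (master system, any `μ ≥ 0`, e.g.
the massless scalar `μ = 0`): every growing mode has `m ≠ 0` and `|ω| < |m|ϖ₁`, `ϖ₁ = a/(r₊² + a²)`.
Hence, if a window contains that half-disc, "no mode off the window" holds with NO cited hypothesis:
* `s = 0`, `μ = 1` column: `WindowConstantsScalarU`, `statementAScalar_of_window`, `msTruncScalarU_of`
  (MS_trunc from the certificates' Statement B̄ alone);
* `μ = 0` column: the SHARP square clause `WindowConstants0'` (`|m|ϖ₁ ≤ R0 m`, no `2Λ/(3Ξ³)` term),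
  `statementA0_of'`, `msTrunc0_of_facts''` (replaces `LConf0` + `WindowConstants0`).
No claim about mode stability beyond these implications.
-/

noncomputable section

open Set

namespace Summit.Ventures.KdS

open Literature.Geometry.Lorentzian Literature.Geometry.Lorentzian.KerrDeSitter

/-! ### `s = 0`, `μ = 1` (Teukolsky scalar column) -/

/-- (H4u) The scalar window contains the disc `|ω| < |m|ϖ₁` (`0 < |m| ≤ M0`), on subextremal parameters
with `a > 0`. -/
def WindowConstantsScalarU (B : Set (ℝ × ℝ × ℝ)) (T : WindowTable) : Prop :=
  ∀ p ∈ B, IsSubextremal p.1 p.2.1 p.2.2 ∧ 0 < p.2.1 ∧ ∀ m : ℝ, |m| ≤ T.M0 → m ≠ 0 →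
    |m| * horizonAngVel p.2.1 (rPlus p.1 p.2.1 p.2.2) ≤ T.R m ∧
      |m| * horizonAngVel p.2.1 (rPlus p.1 p.2.1 p.2.2) ≤ T.h0 m

/-- STATEMENT A, scalar column, WITHOUT cited hypotheses: off the scalar window there is no growing
`s = 0` (μ = 1) mode — from `hasMode_zero_window'` and (H4u). -/
theorem statementAScalar_of_window {B : Set (ℝ × ℝ × ℝ)} {T : WindowTable}
    (h4u : WindowConstantsScalarU B T) : StatementAScalar B T := by
  intro p hp ω m hq hk hmode
  obtain ⟨hIm, hm2, hnotW⟩ := hq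
  change 0 < ω.im at hIm
  change |m| ≤ T.M0 at hm2
  change ω ∉ windowScalar T m at hnotW
  have hm : ∃ k : ℤ, m = k := by simpa using hk
  obtain ⟨hsub, hapos, hconst⟩ := h4u p hp
  obtain ⟨hm0, hw⟩ := hasMode_zero_window' hsub hapos hIm hm hmode
  obtain ⟨hR, hh⟩ := hconst m hm2 hm0
  have hcases : T.R m < |ω.re| ∨ T.h0 m < ω.im := by
    by_contra h
    rw [not_or, not_lt, not_lt] at h
    exact hnotW ⟨hm0, h.1, hIm, h.2⟩
  have hbig : |m| * horizonAngVel p.2.1 (rPlus p.1 p.2.1 p.2.2) ≤ ‖ω‖ := by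
    rcases hcases with hre | him
    · exact hR.trans (hre.le.trans (Complex.abs_re_le_norm ω))
    · exact hh.trans (him.le.trans ((le_abs_self _).trans (Complex.abs_im_le_norm ω)))
  exact absurd hw (not_lt.mpr hbig)

/-- MS_trunc, scalar column, from (H4u) and the certificates' Statement B̄ ALONE (no H1/H2/H3). -/
theorem msTruncScalarU_of {B : Set (ℝ × ℝ × ℝ)} {T : WindowTable} {η : ℝ}
    {Λs : ℝ → ℝ → ℂ → ℝ → Set ℂ} (h4u : WindowConstantsScalarU B T) (hη : 0 ≤ η)
    (hB : StatementBbarScalar B T η Λs) : MSTruncScalar B T Λs :=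
  msTruncScalar_of (statementAScalar_of_window h4u) (statementBScalar_of_bar hη hB)

/-! ### `μ = 0` (massless scalar, master system): the sharp square clause -/

/-- (H4₀′) SHARP μ = 0 window constants: `0 ≤ R0 m` and the square `[−R0 m, R0 m] × (0, R0 m]` contains
the disc `|ω| < |m|ϖ₁` (`|m| ≤ M0`), on subextremal parameters with `a > 0`. -/
def WindowConstants0' (B : Set (ℝ × ℝ × ℝ)) (M0 : ℝ) (R0 : ℝ → ℝ) : Prop :=
  ∀ p ∈ B, IsSubextremal p.1 p.2.1 p.2.2 ∧ 0 < p.2.1 ∧ ∀ m : ℝ, |m| ≤ M0 →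
    0 ≤ R0 m ∧ |m| * horizonAngVel p.2.1 (rPlus p.1 p.2.1 p.2.2) ≤ R0 m

/-- STATEMENT A₀ from the sharp clause alone (`masterMode_zero_window'` at `μ = 0`): off the square
windows there is no growing massless-scalar mode. -/
theorem statementA0_of' {B : Set (ℝ × ℝ × ℝ)} {M0 : ℝ} {R0 : ℝ → ℝ}
    (h4 : WindowConstants0' B M0 R0) : StatementA0 B M0 R0 := by
  intro p hp ω m hq _hk hmode
  obtain ⟨hIm, hm2, hnotW⟩ := hq
  change 0 < ω.im at hIm
  change |m| ≤ M0 at hm2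
  change ω ∉ window0 R0 m at hnotW
  obtain ⟨hsub, hapos, hconst⟩ := h4 p hp
  obtain ⟨lamBar, R, hms⟩ := hmode
  obtain ⟨-, hw⟩ := masterMode_zero_window' hsub hapos le_rfl hIm hms
  obtain ⟨-, hR⟩ := hconst m hm2
  have hcases : R0 m < |ω.re| ∨ R0 m < ω.im := by
    by_contra h
    rw [not_or, not_lt, not_lt] at h
    exact hnotW ⟨h.1, hIm, h.2⟩
  have hbig : |m| * horizonAngVel p.2.1 (rPlus p.1 p.2.1 p.2.2) ≤ ‖ω‖ := by
    rcases hcases with hre | him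
    · exact hR.trans (hre.le.trans (Complex.abs_re_le_norm ω))
    · exact hR.trans (him.le.trans ((le_abs_self _).trans (Complex.abs_im_le_norm ω)))
  exact absurd hw (not_lt.mpr hbig)

/-- MS_trunc₀ from the sharp clause and the μ = 0 certificates' Statement B₀ (no `LConf0`). -/
theorem msTrunc0_of_facts'' {B : Set (ℝ × ℝ × ℝ)} {M0 : ℝ} {R0 : ℝ → ℝ}
    {Λs : ℝ → ℝ → ℂ → ℝ → Set ℂ} (h4 : WindowConstants0' B M0 R0) (hB : StatementB0 B M0 R0 Λs) :
    MSTrunc0 B M0 R0 Λs :=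
  msTrunc0_of (statementA0_of' h4) hB

end Summit.Ventures.KdS

end
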